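import Literature.AlgebraicGeometry.GroupSchemes.BTGroupFrobeniusKernelInCoordinates
import Literature.AlgebraicGeometry.GroupSchemes.FrobeniusKillsImage
import HarnessLib

/-!
# A monogenic one-point closed subgroup of exponent `p^N ≤ q²` dies under `F_q ≫ F_q` of the ambient group

Topic `Literature/AlgebraicGeometry/GroupSchemes`; namespace `Literature.AlgebraicGeometry.GroupSchemes.FrobKill`.  THEOREMS ONLY (no
definition, no named fact, no instance, no notation, no `sorry`).  Cell `hodgecm-mathlib` (D-0151), FLOOR 0, P6 «MOD programme», generic organ paying
`stub_N3_frobeniusIterateKills` of the P6b kit `Lines/F0_P6b_BlockNumerics.lean` (desk F0P6b-plan (g2), DEAL 2026-09-01T17:03:53Z); `--supports stmt-HodgeConjecture-24832`.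
HC_CM is proved only modulo the printed citations until rung 0 closes; this file is generic and changes no count.

THE MATHEMATICS ([SGA3I] VII_A 4.1–4.3; [Demazure1972] Ch. II §7).  `k` a field of exponential characteristic `p`, `q = p^f`.  Let `jU : U ↪ G` be a
closed subgroup (a homomorphism and a clopen immersion with `U` connected — the unit component, though only `IsMonHom jU` is used) of a
`k`-group scheme `G`, with `Γ(U) ≅ k[X]⧸(X^{p^N})` as `k`-algebras (MONOGENIC, one point) and `N ≤ 2f`.  Then `x^{p^{2f}} = 0` for the
generator `x` of the augmentation ideal, so the relative `q²`-Frobenius of `U` is trivial (★ `comp_relFrobeniusOver_eq_one_of_pow_mem_ker`),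
i.e. `F_U ≫ F_{U^{(q)}} = 1` (★ iterate bridge `FrobKill.comp_relFrobeniusOver_frobeniusTwistOver_eq_one_iff`), and by naturality of the relative
Frobenius along `jU` (twice) `jU ≫ F_G ≫ F_{G^{(q)}} = F_U ≫ F_{U^{(q)}} ≫ (jU^{(q)})^{(q)} = 1`.

* `relFrobeniusOver_eq_one_of_algEquiv_quotient_X_pow` (`F^{(t)}_{U∕k} = 1` for monogenic `U` of exponent `p^N ≤ p^t`),
  `comp_relFrobeniusOver_comp_relFrobeniusOver_eq` (the naturality square iterated once),
  **`comp_relFrobeniusOver_comp_relFrobeniusOver_eq_one_of_algEquiv`** (= the text of `stub_N3_frobeniusIterateKills` VERBATIM).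
-/

set_option autoImplicit false

noncomputable section

universe u

open CategoryTheory CategoryTheory.Limits AlgebraicGeometry MonoidalCategory CartesianMonoidalCategory Polynomial
open scoped MonObj Obj

namespace Literature.AlgebraicGeometry.GroupSchemes.FrobKill

open Literature.AlgebraicGeometry.Motives Literature.AlgebraicGeometry.GroupSchemes
open Literature.AlgebraicGeometry.GroupSchemes.AffineGroupScheme (Alg)

variable {k : Type u} [Field k] (p f : ℕ) [ExpChar k p]

set_option synthInstance.maxHeartbeats 200000 in
/-- **A monogenic `k`-group scheme of exponent `p^N ≤ p^t` is killed by its relative `p^t`-Frobenius**: if `Γ(U) ≅ k[X]⧸(X^{p^N})` as `k`-algebras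
and `N ≤ t`, then `F^{(p^t)}_{U∕k} = 1` (the augmentation ideal is generated by the image `x` of `X`, ★ `ker_appTop_unit_eq_span_of_algEquiv`, and
`x^{p^t} = 0`; ★ `comp_relFrobeniusOver_eq_one_of_pow_mem_ker`). [cite: SGA3I, VII_A 4.1] [cite: Demazure1972, Ch. II §7] -/
theorem relFrobeniusOver_eq_one_of_algEquiv_quotient_X_pow (t : ℕ) (U : SchemeOver k) [GrpObj U] [IsAffine U.left]
    {N : ℕ} (θU : (k[X] ⧸ Ideal.span {(X : k[X]) ^ (p ^ N)}) ≃ₐ[k] Alg U) (hN : N ≤ t) :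
    relFrobeniusOver p t U = 1 := by
  have hpN : p ^ N ≠ 0 := pow_ne_zero _ (expChar_pos k p).ne'
  have hx := ker_appTop_unit_eq_span_of_algEquiv (G := U) θU.symm hpN
  rw [AlgEquiv.symm_symm] at hx
  have hq : (Ideal.Quotient.mk (Ideal.span {(X : k[X]) ^ (p ^ N)}) X) ^ p ^ t = 0 := by
    rw [← map_pow, Ideal.Quotient.eq_zero_iff_mem]
    exact Ideal.mem_span_singleton.mpr (pow_dvd_pow X (Nat.pow_le_pow_right (expChar_pos k p) hN))
  have h0 : (θU (Ideal.Quotient.mk _ X) : Γ(U.left, ⊤)) ^ p ^ t = 0 := by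
    rw [← map_pow, hq, map_zero]
  have h := comp_relFrobeniusOver_eq_one_of_pow_mem_ker p t hx (𝟙 U) (by
    rw [RingHom.mem_ker]
    exact (congrArg ((𝟙 U : U ⟶ U).left.appTop.hom) h0).trans (map_zero _))
  rwa [Category.id_comp] at h

set_option maxHeartbeats 800000 in
set_option synthInstance.maxHeartbeats 400000 in
/-- **Naturality of `F ≫ F` along a homomorphism**: `j ≫ F_G ≫ F_{G^{(q)}} = F_U ≫ F_{U^{(q)}} ≫ (j^{(q)})^{(q)}` for a `k`-morphism `j : U ⟶ G`
(★ `relFrobeniusOver_comp_map`, twice). [cite: SGA3I, VII_A 4.1] -/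
theorem comp_relFrobeniusOver_comp_relFrobeniusOver_eq {U G : SchemeOver k} [GrpObj U] [GrpObj G] (j : U ⟶ G) :
    j ≫ relFrobeniusOver p f G ≫ relFrobeniusOver p f (frobeniusTwistOver p f G) =
      relFrobeniusOver p f U ≫ relFrobeniusOver p f (frobeniusTwistOver p f U) ≫
        (Over.pullback (frobSpec k p f)).map ((Over.pullback (frobSpec k p f)).map j) := by
  rw [← relFrobeniusOver_comp_map_assoc p f j, ← relFrobeniusOver_comp_map p f ((Over.pullback (frobSpec k p f)).map j)]

set_option maxHeartbeats 800000 in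
set_option synthInstance.maxHeartbeats 400000 in
/-- **A MONOGENIC ONE-POINT CLOSED SUBGROUP OF EXPONENT `p^N`, `N ≤ 2f`, IS KILLED BY `F_q ≫ F_q` OF THE AMBIENT GROUP** (= the text of
`stub_N3_frobeniusIterateKills` of `Lines/F0_P6b_BlockNumerics.lean`, verbatim): `jU ≫ F_G ≫ F_{G^{(q)}} = 1` for `jU : U ⟶ G` the (unit-component-shaped)
inclusion of a subgroup with `Γ(U) ≃ₐ k[X]⧸(X^{p^N})`, `N ≤ f + f`.  Proof: `F^{(q²)}_U = 1` (`relFrobeniusOver_eq_one_of_algEquiv_quotient_X_pow` at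
`t = f + f`) ⟺ `F_U ≫ F_{U^{(q)}} = 1` (★ iterate bridge `comp_relFrobeniusOver_frobeniusTwistOver_eq_one_iff`), then naturality along `jU`
(`comp_relFrobeniusOver_comp_relFrobeniusOver_eq`) and `1 ≫ (jU^{(q)})^{(q)} = 1`.  Only `IsMonHom jU` of the four clauses is used.
[cite: SGA3I, VII_A 4.1] [cite: Demazure1972, Ch. II §7] -/
theorem comp_relFrobeniusOver_comp_relFrobeniusOver_eq_one_of_algEquiv (G : SchemeOver k) [GrpObj G] [IsAffine G.left]
    [IsFinite G.hom] (U : SchemeOver k) [GrpObj U] [IsAffine U.left] (jU : U ⟶ G)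
    (hU : IsMonHom jU ∧ IsOpenImmersion jU.left ∧ IsClosedImmersion jU.left ∧ ConnectedSpace ↥U.left)
    {N : ℕ} (θU : (k[X] ⧸ Ideal.span {(X : k[X]) ^ (p ^ N)}) ≃ₐ[k] Alg U) (hN : N ≤ f + f) :
    jU ≫ relFrobeniusOver p f G ≫ relFrobeniusOver p f (frobeniusTwistOver p f G) = 1 := by
  haveI := hU.1
  have h2 : relFrobeniusOver p f U ≫ relFrobeniusOver p f (frobeniusTwistOver p f U) = 1 :=
    (comp_relFrobeniusOver_frobeniusTwistOver_eq_one_iff p f U).mpr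
      (relFrobeniusOver_eq_one_of_algEquiv_quotient_X_pow p (f + f) U θU hN)
  rw [comp_relFrobeniusOver_comp_relFrobeniusOver_eq, ← Category.assoc, h2, MonObj.one_comp]

end Literature.AlgebraicGeometry.GroupSchemes.FrobKill

end
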